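import Literature.Probability.Percolation.TargetExplorationHK
import Literature.Probability.Percolation.LonePortSumGeneral
import HarnessLib

/-!
# Cluster conditioning and the two-point covariance: `E[Cov(g(C_s), 1{s ↔ y} | 𝓕(C_v))] ≤ P(y ↮ v | y ↮ s) · Cov(g(C_s), 1{s ↔ y})`

Bernoulli bond percolation on a finite vertex set `V` with
arbitrary edge probabilities `p_e ∈ [0, 1]` (product weights `BHK2006.weight`, configurations `Set (Sym2 V)`),
three vertices `s, y, v`, and an increasing function `g ≥ 0` of van den Berg–Häggström–Kahn's open edge cluster
`C_s = openEdgeCluster ω s`.  Everything in this file is proved; it combines two printed tools: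

* N. Gladkov, *Percolation Inequalities and Decision Trees*, arXiv:2408.08457v2 (2024), **Theorem 3.2** (the
  decision-tree Harris–Kleitman inequality) for the decision tree exploring the open cluster of `v`
  (here `TargetExploration.PrW_mul_PrW_le_Pr2W_hybrid` with target set `∅`), together with his **Lemma 3.1**
  (the swap along a self-determined revealed set preserves the product law; here
  `DecisionTree.sum_pair_reindexW`, `TargetExploration.fin_splice`);
* J. van den Berg, O. Häggström, J. Kahn, *Some conditional correlation inequalities for percolation and
  related processes*, Random Structures Algorithms 29 (2006) 417–435, **Theorem 1.3** in the "cluster /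
  off-cluster" form of pp. 7–8 (here `setSep_offCluster_negCorrelation`).

Write `E` for the product-weight expectation, `Y = {s ↔ y}`, `N = Yᶜ`, `W_v = {y ↔ v}`, and, for a configuration
`ω`, `cut_v(ω) = {e | e meets the open vertex cluster of v}`; given the cluster of `v`, the configuration off
`cut_v(ω)` is fresh, so the conditional covariance of `g(C_s)` and `1_Y` given the exploration σ-field of `C_v` is,
on `{s ↮ v}`, the covariance `c_v(ω)` of `g(C_s(η ∖ cut_v ω))` and `1_Y(η ∖ cut_v ω)` under a fresh `η` (and `0` on
`{s ↔ v}`).  The results: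

* (private plumbing) a finite layer-cake lemma (a linear functional nonnegative on indicators of up-sets is
  nonnegative on monotone nonnegative functions) and the bridge between the finitary calculus
  `DecisionTree.wtW/PrW` on `Finset (Sym2 V)` and the product weights `BHK2006.weight` on `Set (Sym2 V)`;
* the full cluster exploration (`TargetExploration` with target set `∅`): `mem_vis_fin_iff` (it reaches exactly
  the open cluster of `v`), `exists_reachable_of_mem_revealedAt` (it reveals only pairs meeting that cluster),
  `reachable_hybrid_iff` / `openEdgeCluster_hybrid_eq` (the hybrid "`ω` on the revealed set, `η` elsewhere" has
  the same cluster of `v`, and, when `s ∉ C_v(ω)`, the cluster of `s` of the configuration `η ∖ cut_v(ω)`);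
* `sum_condExpV` / `sum_condExpV_mul` (the hybrid has the product law; tower property — Lemma 3.1), `harris_hybrid_ind` /
  **`harris_hybrid_of_monotone`** (Theorem 3.2 for this tree, for an up-set and for a monotone `g ≥ 0`:
  "the conditional expectations given the cluster of `v` of two increasing functions are positively correlated");
* **`clusterConditioning_cov_le`** — the inequality of the title,
  `E[1{s ↮ v} · c_v] ≤ (1 − E[1_N 1_{W_v}] / E[1_N]) · Cov(g(C_s), 1_Y)`,
  and `clusterConditioning_cov_le'`, the same statement in the letter of the hypothesis `hPv` of the hull-port
  induction (`HullPort.taB_insert_le`): cluster conditioning explains at least the fraction `P(y ↔ v | y ↮ s)`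
  of `Cov(g(C_s), 1_Y)`.

Proof of the main inequality: with `𝓕 = 𝓕(C_v)` and the increasing event
`F = Y ∪ W_v`, pointwise `1_F = 1_Y + 1_N 1_{W_v}` and `1_N 1_{W_v}` is `𝓕`-measurable, so by Theorem 3.2
`E[g · E[1_Y | 𝓕]] ≥ E g · E 1_Y − Cov(g, 1_N 1_{W_v})`, while `Cov(g, 1_N 1_{W_v}) ≤ −(E[1_N 1_{W_v}]/E[1_N]) Cov(g, 1_Y)`
by the off-cluster negative correlation of `g(C_s)` and `1{y ↔ v}` given `s ↮ y`; and
`E[1{s ↮ v} c_v] = E[g 1_Y] − E[g · E[1_Y | 𝓕]]` by the product law of the hybrid.  Not in print in this form;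
derived here from the two printed theorems.

## References
* N. Gladkov, *Percolation Inequalities and Decision Trees*, arXiv:2408.08457v2 (2024), Lemma 3.1, Thm. 3.2,
  Example 2.5. [Gladkov2024]
* J. van den Berg, O. Häggström, J. Kahn, *Some conditional correlation inequalities for percolation and related
  processes*, Random Structures Algorithms 29 (2006) 417–435, Thm. 1.3 and pp. 7–8. [VandenbergHaggstromKahn2005]
-/

noncomputable section

open Classical

namespace Literature.Probability.Percolation

namespace ClusterConditioning

open Finset DecisionTree BHK2006 TargetExploration MeasureTheory LonePortSum LonePortSumGeneral
open Literature.Probability.LatticeModels (prodBernoulli)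

/-! ### Finite layer-cake: from up-set indicators to monotone nonnegative functions -/

section LayerCake

variable {α : Type*} [Fintype α] [PartialOrder α]

/-- **Finite layer-cake.**  If a linear functional `f ↦ Σ_a c(a) f(a)` on the functions on a finite poset is
nonnegative on the indicator of every up-set, it is nonnegative on every monotone `f ≥ 0` (induction on the
number of points where `f > 0`: subtract `(min_{f>0} f) · 1_{f>0}`). [folklore] -/
private theorem sum_mul_nonneg_of_monotone (c : α → ℝ)
    (hup : ∀ X : Set α, IsUpperSet X → 0 ≤ ∑ a, c a * ind X a)
    {f : α → ℝ} (hf : Monotone f) (hf0 : ∀ a, 0 ≤ f a) : 0 ≤ ∑ a, c a * f a := by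
  suffices h : ∀ (k : ℕ) (f : α → ℝ), Monotone f → (∀ a, 0 ≤ f a) →
      (Finset.univ.filter fun a => 0 < f a).card ≤ k → 0 ≤ ∑ a, c a * f a from
    h _ f hf hf0 le_rfl
  intro k
  induction k with
  | zero =>
    intro f hf hf0 hk
    have hz : ∀ a, f a = 0 := fun a => by
      have hk' : (Finset.univ.filter fun a => 0 < f a) = ∅ :=
        Finset.card_eq_zero.1 (Nat.le_zero.1 hk)
      have : a ∉ Finset.univ.filter fun a => 0 < f a := by rw [hk']; exact Finset.notMem_empty a
      simp only [Finset.mem_filter, Finset.mem_univ, true_and, not_lt] at this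
      exact le_antisymm this (hf0 a)
    simp [hz]
  | succ k ih =>
    intro f hf hf0 hk
    set X : Finset α := Finset.univ.filter fun a => 0 < f a with hX
    have hmemX : ∀ a, a ∈ X ↔ 0 < f a := fun a => by simp [hX]
    by_cases hXe : X = ∅
    · have hz : ∀ a, f a = 0 := fun a => by
        have : ¬ 0 < f a := fun h => by
          have ha := (hmemX a).2 h
          rw [hXe] at ha
          exact Finset.notMem_empty a ha
        exact le_antisymm (not_lt.1 this) (hf0 a)
      simp [hz]
    · have hXne : X.Nonempty := Finset.nonempty_iff_ne_empty.2 hXe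
      set m : ℝ := (X.image f).min' (hXne.image f) with hm
      have hmX : ∀ a ∈ X, m ≤ f a := fun a ha =>
        Finset.min'_le _ _ (Finset.mem_image_of_mem f ha)
      obtain ⟨a₀, ha₀X, ha₀⟩ : ∃ a₀ ∈ X, f a₀ = m := by
        have hmem : m ∈ X.image f := Finset.min'_mem (X.image f) (hXne.image f)
        obtain ⟨a₀, ha₀, h⟩ := Finset.mem_image.1 hmem
        exact ⟨a₀, ha₀, h⟩
      have hm0 : 0 < m := by rw [← ha₀]; exact (hmemX a₀).1 ha₀X
      -- the up-set `{f > 0}`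
      set U : Set α := {a | 0 < f a} with hU
      have hUup : IsUpperSet U := fun a b hab ha => lt_of_lt_of_le ha (hf hab)
      -- the reduced function
      set f' : α → ℝ := fun a => f a - m * ind U a with hf'
      have hf'U : ∀ a, 0 < f a → f' a = f a - m := fun a ha => by
        simp only [hf', ind_of_mem (show a ∈ U from ha), mul_one]
      have hf'0 : ∀ a, ¬ 0 < f a → f' a = 0 := fun a ha => by
        simp only [hf', ind_of_not_mem (show a ∉ U from ha), mul_zero, sub_zero]
        exact le_antisymm (not_lt.1 ha) (hf0 a)
      have hf'nn : ∀ a, 0 ≤ f' a := fun a => by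
        by_cases ha : 0 < f a
        · rw [hf'U a ha]; exact sub_nonneg.2 (hmX a ((hmemX a).2 ha))
        · rw [hf'0 a ha]
      have hf'mono : Monotone f' := by
        intro a b hab
        by_cases ha : 0 < f a
        · have hb : 0 < f b := lt_of_lt_of_le ha (hf hab)
          rw [hf'U a ha, hf'U b hb]; exact sub_le_sub_right (hf hab) m
        · rw [hf'0 a ha]; exact hf'nn b
      have hcard : (Finset.univ.filter fun a => 0 < f' a).card ≤ k := by
        have hsub : (Finset.univ.filter fun a => 0 < f' a) ⊆ X.erase a₀ := by
          intro a ha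
          simp only [Finset.mem_filter, Finset.mem_univ, true_and] at ha
          rw [Finset.mem_erase, hmemX]
          by_cases hfa : 0 < f a
          · refine ⟨?_, hfa⟩
            rintro rfl
            rw [hf'U _ hfa, ha₀, sub_self] at ha
            exact lt_irrefl _ ha
          · rw [hf'0 a hfa] at ha; exact absurd ha (lt_irrefl _)
        have h1 := Finset.card_le_card hsub
        rw [Finset.card_erase_of_mem ha₀X] at h1
        have h2 : X.card ≤ k + 1 := hk
        omega
      have h1 := ih f' hf'mono hf'nn hcard
      have h2 := hup U hUup
      have hsum : ∑ a, c a * f a = ∑ a, c a * f' a + m * ∑ a, c a * ind U a := by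
        rw [Finset.mul_sum, ← Finset.sum_add_distrib]
        refine Finset.sum_congr rfl fun a _ => ?_
        simp only [hf']; ring
      rw [hsum]
      exact add_nonneg h1 (mul_nonneg hm0.le h2)

end LayerCake

/-! ### The bridge between `DecisionTree.wtW` on `Finset` configurations and `BHK2006.weight` on `Set` configurations -/

section Bridge

variable {ι : Type*} [Fintype ι] [DecidableEq ι]

/-- Over the full coordinate set, Gladkov's weight of a `Finset` configuration is BHK's product weight of its
coercion. [folklore] -/
private theorem wtW_univ_eq_weight (p : ι → ℝ) (K : Finset ι) :
    wtW Finset.univ p K = weight p (↑K : Set ι) := by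
  unfold wtW weight
  refine Finset.prod_congr rfl fun i _ => ?_
  by_cases hi : i ∈ K
  · rw [if_pos hi, if_pos (Finset.mem_coe.2 hi)]
  · rw [if_neg hi, if_neg (fun h => hi (Finset.mem_coe.1 h))]

/-- **Bridge**: a `wtW`-weighted sum over all `Finset` configurations is the `weight`-weighted sum over all
`Set` configurations. [folklore] -/
private theorem sum_powerset_univ_eq_sum_set (p : ι → ℝ) (Φ : Set ι → ℝ) :
    ∑ K ∈ (Finset.univ : Finset ι).powerset, wtW Finset.univ p K * Φ ↑K =
      ∑ ω : Set ι, weight p ω * Φ ω := by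
  rw [Finset.powerset_univ]
  exact Fintype.sum_equiv Fintype.finsetEquivSet _ _ fun K => by
    rw [Fintype.finsetEquivSet_apply, wtW_univ_eq_weight]

omit [DecidableEq ι] in
/-- The inverse of `Fintype.finsetEquivSet` on a coerced `Finset`. [folklore] -/
private theorem finsetEquivSet_symm_coe (K : Finset ι) :
    (Fintype.finsetEquivSet (α := ι)).symm (↑K : Set ι) = K :=
  (Fintype.finsetEquivSet (α := ι)).symm_apply_apply K

omit [DecidableEq ι] in
/-- The coercion of the inverse of `Fintype.finsetEquivSet`. [folklore] -/
private theorem coe_finsetEquivSet_symm (ω : Set ι) :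
    (↑((Fintype.finsetEquivSet (α := ι)).symm ω) : Set ι) = ω :=
  (Fintype.finsetEquivSet (α := ι)).apply_symm_apply ω

/-- Total mass one for the product weights (any real parameters). [folklore] -/
private theorem sum_weight_eq_one (p : ι → ℝ) : ∑ ω : Set ι, weight p ω = 1 := by
  have h := sum_powerset_univ_eq_sum_set p fun _ => 1
  simp only [mul_one] at h
  rw [← h]
  exact sum_wtW Finset.univ p

end Bridge

/-! ### The exploration of the whole open cluster of `v` (`TargetExploration` with target set `∅`) -/

section Exploration

variable {V : Type*} [Fintype V]

/-- With no target, the final state of the exploration has an empty boundary. [cite: Gladkov2024, Example 2.5 (the algorithm determining C_v)] -/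
theorem bnd_fin_eq_empty (v : V) (K : Finset (Sym2 V)) :
    bnd (Finset.univ : Finset (Sym2 V)) (fin Finset.univ (∅ : Finset V) v K) = ∅ := by
  rcases halted_fin (D := (Finset.univ : Finset (Sym2 V))) (A := (∅ : Finset V)) (o := v) K with h | h
  · simp at h
  · exact h

/-- **The exploration with no target reaches exactly the open cluster of `v`.**
[cite: Gladkov2024, Example 2.5 (the algorithm determining C_v)] -/
theorem mem_vis_fin_iff (v : V) (K : Finset (Sym2 V)) (u : V) :
    u ∈ (fin (Finset.univ : Finset (Sym2 V)) (∅ : Finset V) v K).vis ↔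
      (openGraph (↑K : Set (Sym2 V))).Reachable v u := by
  constructor
  · intro hu
    exact ((inv_fin K).reach u hu).mono (openGraph_mono (Finset.coe_subset.2 Finset.inter_subset_right))
  · intro hu
    by_contra hnot
    set σ := fin (Finset.univ : Finset (Sym2 V)) (∅ : Finset V) v K with hσ
    have hinv : Inv Finset.univ ∅ v K σ := inv_fin K
    have hbnd : bnd Finset.univ σ = ∅ := bnd_fin_eq_empty v K
    obtain ⟨w⟩ := hu
    obtain ⟨d, -, hd1, hd2⟩ := w.exists_boundary_dart (↑σ.vis) (Finset.mem_coe.2 hinv.root)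
      (fun h => hnot (Finset.mem_coe.1 h))
    have hadj := d.adj
    rw [openGraph_adj] at hadj
    obtain ⟨hmem, hne⟩ := hadj
    have hmemK : s(d.toProd.1, d.toProd.2) ∈ K := Finset.mem_coe.1 hmem
    have hnotrev : s(d.toProd.1, d.toProd.2) ∉ σ.rev := fun hrev =>
      hd2 (Finset.mem_coe.2 (hinv.open_vis _ hrev hmemK _ (Sym2.mem_mk_right _ _)))
    have hin : s(d.toProd.1, d.toProd.2) ∈ bnd Finset.univ σ :=
      mem_bnd.2 ⟨⟨d.toProd.1, Finset.mem_coe.1 hd1, d.toProd.2, fun h => hd2 (Finset.mem_coe.2 h), rfl⟩,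
        Finset.mem_univ _, hnotrev⟩
    rw [hbnd] at hin
    exact Finset.notMem_empty _ hin

/-- **The exploration reveals only pairs meeting the cluster of `v`.** [cite: Gladkov2024, Example 2.5] -/
theorem exists_reachable_of_mem_revealedAt {v : V} {K : Finset (Sym2 V)} {e : Sym2 V}
    (he : e ∈ revealedAt (Finset.univ : Finset (Sym2 V)) (∅ : Finset V) v K) :
    ∃ u ∈ e, (openGraph (↑K : Set (Sym2 V))).Reachable v u := by
  obtain ⟨u, hu, hue⟩ := (inv_fin K).touch e he
  exact ⟨u, hue, (mem_vis_fin_iff v K u).1 hu⟩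

/-- **The hybrid keeps the cluster of `v`**: splicing `K` (on its revealed set) with any `C` (elsewhere) does not
change which vertices are joined to `v`. [cite: Gladkov2024, Lemma 3.1 (S(C₁ →_S C₂) = S(C₁))] -/
theorem reachable_hybrid_iff (v : V) (K C : Finset (Sym2 V)) (u : V) :
    (openGraph (↑(splice (revealedAt (Finset.univ : Finset (Sym2 V)) (∅ : Finset V) v K) K C) :
        Set (Sym2 V))).Reachable v u ↔
      (openGraph (↑K : Set (Sym2 V))).Reachable v u := by
  rw [← mem_vis_fin_iff, ← mem_vis_fin_iff,
    fin_splice (D := (Finset.univ : Finset (Sym2 V))) (A := (∅ : Finset V)) (o := v) K C]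

/-- Off the pairs meeting the cluster of `v`, the hybrid is the second configuration. [folklore] -/
private theorem mem_hybrid_iff_of_not_cut {v : V} {K : Finset (Sym2 V)} (C : Finset (Sym2 V)) {e : Sym2 V}
    (he : ¬ ∃ u ∈ e, (openGraph (↑K : Set (Sym2 V))).Reachable v u) :
    e ∈ splice (revealedAt (Finset.univ : Finset (Sym2 V)) (∅ : Finset V) v K) K C ↔ e ∈ C :=
  mem_splice_of_not_mem fun h => he (exists_reachable_of_mem_revealedAt h)

/-- The hybrid of a hybrid (same first configuration on the revealed set) is the hybrid. [cite: Gladkov2024, Lemma 3.1] -/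
theorem hybrid_hybrid (v : V) (K C C' : Finset (Sym2 V)) :
    splice (revealedAt (Finset.univ : Finset (Sym2 V)) (∅ : Finset V) v
        (splice (revealedAt (Finset.univ : Finset (Sym2 V)) (∅ : Finset V) v K) K C))
      (splice (revealedAt (Finset.univ : Finset (Sym2 V)) (∅ : Finset V) v K) K C) C' =
    splice (revealedAt (Finset.univ : Finset (Sym2 V)) (∅ : Finset V) v K) K C' := by
  have h1 : revealedAt (Finset.univ : Finset (Sym2 V)) (∅ : Finset V) v
      (splice (revealedAt (Finset.univ : Finset (Sym2 V)) (∅ : Finset V) v K) K C) =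
      revealedAt (Finset.univ : Finset (Sym2 V)) (∅ : Finset V) v K :=
    congrArg St.rev (fin_splice (D := (Finset.univ : Finset (Sym2 V))) (A := (∅ : Finset V)) (o := v) K C)
  rw [h1]
  exact splice_congr_left (splice_agree _ K C) C'

end Exploration

/-! ### The hybrid at the level of `Set (Sym2 V)` configurations -/

section SetLevel

variable {V : Type*} [Fintype V]

/-- The pairs meeting the open vertex cluster of `v` in `ω` (the set revealed by conditioning on the cluster of
`v`; `= A_{{v}}(ω)` of `TwoClusterGibbsCovariance`). [cite: VandenbergHaggstromKahn2005, §1 pp. 7–8 (the pairs W̄ deleted given the cluster)] -/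
def cutSet (v : V) (ω : Set (Sym2 V)) : Set (Sym2 V) := {e | ∃ u ∈ e, (openGraph ω).Reachable v u}

/-- **The hybrid configuration** `ω →_{S(ω)} η`: `ω` on the set revealed by the exploration of the cluster of `v`
in `ω`, `η` elsewhere (Gladkov's `C₁ →_S C₂`, transported to `Set` configurations). [cite: Gladkov2024, Def. 2.3–2.4] -/
def hybrid (v : V) (ω η : Set (Sym2 V)) : Set (Sym2 V) :=
  ↑(splice (revealedAt (Finset.univ : Finset (Sym2 V)) (∅ : Finset V) v
        ((Fintype.finsetEquivSet (α := Sym2 V)).symm ω))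
      ((Fintype.finsetEquivSet (α := Sym2 V)).symm ω) ((Fintype.finsetEquivSet (α := Sym2 V)).symm η))

/-- The hybrid of coerced `Finset` configurations. [folklore] -/
private theorem hybrid_coe (v : V) (K C : Finset (Sym2 V)) :
    hybrid v (↑K : Set (Sym2 V)) ↑C =
      ↑(splice (revealedAt (Finset.univ : Finset (Sym2 V)) (∅ : Finset V) v K) K C) := by
  simp only [hybrid, finsetEquivSet_symm_coe]

/-- The hybrid keeps the cluster of `v`. [cite: Gladkov2024, Lemma 3.1] -/
theorem reachable_hybrid_iff' (v : V) (ω η : Set (Sym2 V)) (u : V) :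
    (openGraph (hybrid v ω η)).Reachable v u ↔ (openGraph ω).Reachable v u := by
  have h := reachable_hybrid_iff v ((Fintype.finsetEquivSet (α := Sym2 V)).symm ω)
    ((Fintype.finsetEquivSet (α := Sym2 V)).symm η) u
  rw [coe_finsetEquivSet_symm] at h
  exact h

/-- The hybrid of a hybrid is the hybrid. [cite: Gladkov2024, Lemma 3.1] -/
theorem hybrid_hybrid' (v : V) (ω η η' : Set (Sym2 V)) : hybrid v (hybrid v ω η) η' = hybrid v ω η' := by
  unfold hybrid
  rw [finsetEquivSet_symm_coe, hybrid_hybrid]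

/-- Off `cutSet v ω`, the hybrid is `η`. [folklore] -/
private theorem mem_hybrid_iff_of_not_cut' {v : V} {ω : Set (Sym2 V)} (η : Set (Sym2 V)) {e : Sym2 V}
    (he : e ∉ cutSet v ω) : e ∈ hybrid v ω η ↔ e ∈ η := by
  have he' : ¬ ∃ u ∈ e, (openGraph (↑((Fintype.finsetEquivSet (α := Sym2 V)).symm ω) :
      Set (Sym2 V))).Reachable v u := by
    rw [coe_finsetEquivSet_symm]; exact he
  have h := mem_hybrid_iff_of_not_cut ((Fintype.finsetEquivSet (α := Sym2 V)).symm η) he'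
  rw [← Finset.mem_coe, ← Finset.mem_coe (s := (Fintype.finsetEquivSet (α := Sym2 V)).symm η),
    coe_finsetEquivSet_symm η] at h
  exact h

omit [Fintype V] in
/-- `cutSet v θ` is the set `W̄` of pairs meeting `{v} ∪ V(C_v)`. [folklore] -/
private theorem bar_eq_cutSet (v : V) (θ : Set (Sym2 V)) :
    {e : Sym2 V | ∃ u ∈ e, u = v ∨ ∃ e' ∈ openEdgeCluster θ v, u ∈ e'} = cutSet v θ := by
  ext e
  simp only [cutSet, Set.mem_setOf_eq, ← reachable_iff_exists_mem_openEdgeCluster]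

/-- The hybrid has the cut set of `ω`. [folklore] -/
private theorem cutSet_hybrid (v : V) (ω η : Set (Sym2 V)) : cutSet v (hybrid v ω η) = cutSet v ω := by
  ext e; simp only [cutSet, Set.mem_setOf_eq, reachable_hybrid_iff']

/-- Off the cut set of `ω`, the hybrid and `η` agree. [folklore] -/
private theorem hybrid_diff_cutSet (v : V) (ω η : Set (Sym2 V)) :
    hybrid v ω η \ cutSet v ω = η \ cutSet v ω := by
  ext e
  simp only [Set.mem_sdiff]
  constructor
  · rintro ⟨h1, h2⟩; exact ⟨(mem_hybrid_iff_of_not_cut' η h2).1 h1, h2⟩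
  · rintro ⟨h1, h2⟩; exact ⟨(mem_hybrid_iff_of_not_cut' η h2).2 h1, h2⟩

/-- **The cluster of `s ∉ C_v` in the hybrid** is the cluster of `s` in the configuration `η` with the pairs
meeting `C_v(ω)` deleted ("in `G − C̄_v` under the same weights").
[cite: VandenbergHaggstromKahn2005, §1 p. 8 (the cluster of t given C_s lives in G − W̄)] -/
theorem openEdgeCluster_hybrid_eq {v s : V} {ω : Set (Sym2 V)} (hs : ¬ (openGraph ω).Reachable v s)
    (η : Set (Sym2 V)) :
    openEdgeCluster (hybrid v ω η) s = openEdgeCluster (η \ cutSet v ω) s := by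
  have hs' : ¬ (openGraph (hybrid v ω η)).Reachable v s := by rwa [reachable_hybrid_iff']
  have ht : ¬ (s = v ∨ ∃ e ∈ openEdgeCluster (hybrid v ω η) v, s ∈ e) := by
    rwa [← reachable_iff_exists_mem_openEdgeCluster]
  rw [openEdgeCluster_eq_sdiff_bar rfl ht, bar_eq_cutSet, cutSet_hybrid, hybrid_diff_cutSet]

/-- The connections of `s ∉ C_v` in the hybrid are those of `η` with the pairs meeting `C_v(ω)` deleted.
[cite: VandenbergHaggstromKahn2005, §1 p. 8] -/
theorem reachable_hybrid_iff_diff_cutSet {v s : V} {ω : Set (Sym2 V)}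
    (hs : ¬ (openGraph ω).Reachable v s) (η : Set (Sym2 V)) (t : V) :
    (openGraph (hybrid v ω η)).Reachable s t ↔ (openGraph (η \ cutSet v ω)).Reachable s t := by
  have hs' : ¬ (openGraph (hybrid v ω η)).Reachable v s := by rwa [reachable_hybrid_iff']
  rw [← reachable_sdiff_bar_iff hs' t, bar_eq_cutSet, cutSet_hybrid, hybrid_diff_cutSet]

/-! ### Conditional expectation given the exploration of `C_v`; the product law of the hybrid -/

/-- `E[Φ | 𝓕(C_v)](ω) = Σ_η weight(η) Φ(ω →_{S(ω)} η)`: the conditional expectation of `Φ` given the exploration of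
the cluster of `v`. [cite: Gladkov2024, §2 (the hybrid C₁ →_S C₂)] -/
def condExpV (p : Sym2 V → ℝ) (v : V) (Φ : Set (Sym2 V) → ℝ) (ω : Set (Sym2 V)) : ℝ :=
  ∑ η, weight p η * Φ (hybrid v ω η)

/-- **The hybrid has the product law** (Gladkov's Lemma 3.1 for the cluster exploration):
`Σ_ω weight(ω) E[Φ | 𝓕(C_v)](ω) = Σ_ω weight(ω) Φ(ω)`. [cite: Gladkov2024, Lemma 3.1] -/
theorem sum_condExpV (p : Sym2 V → ℝ) (v : V) (Φ : Set (Sym2 V) → ℝ) :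
    ∑ ω, weight p ω * condExpV p v Φ ω = ∑ ω, weight p ω * Φ ω := by
  -- the finitary statement
  have hfin : ∑ K ∈ (Finset.univ : Finset (Sym2 V)).powerset, wtW Finset.univ p K *
      (∑ C ∈ (Finset.univ : Finset (Sym2 V)).powerset, wtW Finset.univ p C *
        Φ ↑(splice (revealedAt (Finset.univ : Finset (Sym2 V)) (∅ : Finset V) v K) K C)) =
      ∑ K ∈ (Finset.univ : Finset (Sym2 V)).powerset, wtW Finset.univ p K * Φ ↑K := by
    have h := sum_pair_reindexW (Finset.univ : Finset (Sym2 V)) p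
      (selfDetermined_revealedAt (D := (Finset.univ : Finset (Sym2 V))) (A := (∅ : Finset V)) (o := v))
      (fun x => Φ ↑x.1)
    rw [Finset.sum_product, Finset.sum_product] at h
    symm
    calc ∑ K ∈ (Finset.univ : Finset (Sym2 V)).powerset, wtW Finset.univ p K * Φ ↑K
        = ∑ K ∈ (Finset.univ : Finset (Sym2 V)).powerset,
            ∑ C ∈ (Finset.univ : Finset (Sym2 V)).powerset,
              wt2W Finset.univ p (K, C) * Φ ↑(K, C).1 := by
          refine Finset.sum_congr rfl fun K _ => ?_
          simp only [wt2W]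
          rw [← Finset.sum_mul, ← Finset.mul_sum, sum_wtW, mul_one]
      _ = ∑ K ∈ (Finset.univ : Finset (Sym2 V)).powerset,
            ∑ C ∈ (Finset.univ : Finset (Sym2 V)).powerset,
              wt2W Finset.univ p (K, C) *
                Φ ↑(swapPair (revealedAt (Finset.univ : Finset (Sym2 V)) (∅ : Finset V) v) (K, C)).1 := h
      _ = _ := by
          refine Finset.sum_congr rfl fun K _ => ?_
          rw [Finset.mul_sum]
          refine Finset.sum_congr rfl fun C _ => ?_
          simp only [wt2W, swapPair, mul_assoc]
  calc ∑ ω, weight p ω * condExpV p v Φ ω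
      = ∑ K ∈ (Finset.univ : Finset (Sym2 V)).powerset, wtW Finset.univ p K * condExpV p v Φ ↑K :=
        (sum_powerset_univ_eq_sum_set p _).symm
    _ = ∑ K ∈ (Finset.univ : Finset (Sym2 V)).powerset, wtW Finset.univ p K *
          (∑ C ∈ (Finset.univ : Finset (Sym2 V)).powerset, wtW Finset.univ p C *
            Φ ↑(splice (revealedAt (Finset.univ : Finset (Sym2 V)) (∅ : Finset V) v K) K C)) := by
        refine Finset.sum_congr rfl fun K _ => ?_
        congr 1
        rw [condExpV, ← sum_powerset_univ_eq_sum_set p (fun η => Φ (hybrid v ↑K η))]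
        refine Finset.sum_congr rfl fun C _ => ?_
        rw [hybrid_coe]
    _ = ∑ K ∈ (Finset.univ : Finset (Sym2 V)).powerset, wtW Finset.univ p K * Φ ↑K := hfin
    _ = ∑ ω, weight p ω * Φ ω := sum_powerset_univ_eq_sum_set p Φ

/-- The conditional expectation is measurable for the exploration: it takes the same value at every hybrid
of `ω`. [cite: Gladkov2024, Lemma 3.1] -/
theorem condExpV_hybrid (p : Sym2 V → ℝ) (v : V) (Φ : Set (Sym2 V) → ℝ) (ω η₀ : Set (Sym2 V)) :
    condExpV p v Φ (hybrid v ω η₀) = condExpV p v Φ ω := by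
  unfold condExpV
  simp only [hybrid_hybrid']

/-- **Tower property**: for `Ψ` measurable for the exploration (constant along hybrids),
`Σ_ω weight(ω) E[Φ | 𝓕](ω) Ψ(ω) = Σ_ω weight(ω) Φ(ω) Ψ(ω)`. [cite: Gladkov2024, Lemma 3.1] -/
theorem sum_condExpV_mul (p : Sym2 V → ℝ) (v : V) (Φ Ψ : Set (Sym2 V) → ℝ)
    (hΨ : ∀ ω η, Ψ (hybrid v ω η) = Ψ ω) :
    ∑ ω, weight p ω * (condExpV p v Φ ω * Ψ ω) = ∑ ω, weight p ω * (Φ ω * Ψ ω) := by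
  rw [← sum_condExpV p v (fun ω => Φ ω * Ψ ω)]
  refine Finset.sum_congr rfl fun ω _ => ?_
  congr 1
  simp only [condExpV, hΨ, Finset.sum_mul]
  refine Finset.sum_congr rfl fun η _ => ?_
  ring

/-! ### Gladkov's decision-tree Harris–Kleitman inequality for the cluster exploration -/

/-- **Theorem 3.2 for the cluster exploration, up-sets**: for up-closed `X, F`,
`E[1_X] E[1_F] ≤ E[1_X · E[1_F | 𝓕(C_v)]]`. [cite: Gladkov2024, Thm. 3.2 (p. 4)] -/
theorem harris_hybrid_ind {p : Sym2 V → ℝ} (hp0 : ∀ e, 0 ≤ p e) (hp1 : ∀ e, p e ≤ 1) (v : V)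
    {X F : Set (Set (Sym2 V))} (hX : IsUpperSet X) (hF : IsUpperSet F) :
    (∑ ω, weight p ω * ind X ω) * (∑ ω, weight p ω * ind F ω) ≤
      ∑ ω, weight p ω * (ind X ω * condExpV p v (ind F) ω) := by
  set X' : Set (Finset (Sym2 V)) := {K | (↑K : Set (Sym2 V)) ∈ X} with hX'
  set F' : Set (Finset (Sym2 V)) := {K | (↑K : Set (Sym2 V)) ∈ F} with hF'
  have hX'u : IsUpperSet X' := fun K K' hKK' hK => hX (Finset.coe_subset.2 hKK') hK
  have hF'u : IsUpperSet F' := fun K K' hKK' hK => hF (Finset.coe_subset.2 hKK') hK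
  have h := PrW_mul_PrW_le_Pr2W_hybrid (Finset.univ : Finset (Sym2 V)) (∅ : Finset V) v hp0 hp1 hX'u hF'u
  have hindX : ∀ K : Finset (Sym2 V), ind X' K = ind X ↑K := fun K => by
    simp only [ind, hX', Set.mem_setOf_eq]
  have hindF : ∀ K : Finset (Sym2 V), ind F' K = ind F ↑K := fun K => by
    simp only [ind, hF', Set.mem_setOf_eq]
  have e1 : PrW Finset.univ p X' = ∑ ω, weight p ω * ind X ω := by
    rw [PrW_eq_sum_ind, ← sum_powerset_univ_eq_sum_set]; simp only [hindX]
  have e2 : PrW Finset.univ p F' = ∑ ω, weight p ω * ind F ω := by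
    rw [PrW_eq_sum_ind, ← sum_powerset_univ_eq_sum_set]; simp only [hindF]
  have e3 : Pr2W Finset.univ p {c : Finset (Sym2 V) × Finset (Sym2 V) | c.1 ∈ X' ∧
      splice (revealedAt (Finset.univ : Finset (Sym2 V)) (∅ : Finset V) v c.1) c.1 c.2 ∈ F'} =
      ∑ ω, weight p ω * (ind X ω * condExpV p v (ind F) ω) := by
    rw [Pr2W_eq_sum_ind, Finset.sum_product, ← sum_powerset_univ_eq_sum_set]
    refine Finset.sum_congr rfl fun K _ => ?_
    rw [condExpV, ← sum_powerset_univ_eq_sum_set p (fun η => ind F (hybrid v ↑K η)), Finset.mul_sum,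
      Finset.mul_sum]
    refine Finset.sum_congr rfl fun C _ => ?_
    rw [hybrid_coe]
    have hind : ind {c : Finset (Sym2 V) × Finset (Sym2 V) | c.1 ∈ X' ∧
        splice (revealedAt (Finset.univ : Finset (Sym2 V)) (∅ : Finset V) v c.1) c.1 c.2 ∈ F'} (K, C) =
        ind X' K * ind F' (splice (revealedAt (Finset.univ : Finset (Sym2 V)) (∅ : Finset V) v K) K C) := by
      by_cases h1 : K ∈ X'
      · by_cases h2 : splice (revealedAt (Finset.univ : Finset (Sym2 V)) (∅ : Finset V) v K) K C ∈ F'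
        · rw [ind_of_mem h1, ind_of_mem h2, ind_of_mem (show (K, C) ∈ {c : Finset (Sym2 V) × Finset (Sym2 V) |
            c.1 ∈ X' ∧ splice (revealedAt (Finset.univ : Finset (Sym2 V)) (∅ : Finset V) v c.1) c.1 c.2 ∈ F'}
            from ⟨h1, h2⟩)]
          norm_num
        · rw [ind_of_mem h1, ind_of_not_mem h2, ind_of_not_mem (show (K, C) ∉ {c : Finset (Sym2 V) × Finset (Sym2 V) |
            c.1 ∈ X' ∧ splice (revealedAt (Finset.univ : Finset (Sym2 V)) (∅ : Finset V) v c.1) c.1 c.2 ∈ F'}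
            from fun h => h2 h.2)]
          norm_num
      · rw [ind_of_not_mem h1, ind_of_not_mem (show (K, C) ∉ {c : Finset (Sym2 V) × Finset (Sym2 V) |
            c.1 ∈ X' ∧ splice (revealedAt (Finset.univ : Finset (Sym2 V)) (∅ : Finset V) v c.1) c.1 c.2 ∈ F'}
            from fun h => h1 h.1)]
        norm_num
    rw [hind, hindX, hindF, wt2W]
    ring
  rw [e1, e2, e3] at h
  exact h

/-- **Theorem 3.2 for the cluster exploration, monotone functions**: for `f ≥ 0` increasing and `F` up-closed,
`E[f] E[1_F] ≤ E[f · E[1_F | 𝓕(C_v)]]` (from the up-set case by the finite layer-cake).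
[cite: Gladkov2024, Thm. 3.2 (p. 4)] -/
theorem harris_hybrid_of_monotone {p : Sym2 V → ℝ} (hp0 : ∀ e, 0 ≤ p e) (hp1 : ∀ e, p e ≤ 1) (v : V)
    {f : Set (Sym2 V) → ℝ} (hf : Monotone f) (hf0 : ∀ ω, 0 ≤ f ω)
    {F : Set (Set (Sym2 V))} (hF : IsUpperSet F) :
    (∑ ω, weight p ω * f ω) * (∑ ω, weight p ω * ind F ω) ≤
      ∑ ω, weight p ω * (f ω * condExpV p v (ind F) ω) := by
  set PF : ℝ := ∑ ω, weight p ω * ind F ω with hPF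
  have key := sum_mul_nonneg_of_monotone (fun ω => weight p ω * (condExpV p v (ind F) ω - PF)) ?_ hf hf0
  · have hre : ∑ ω, weight p ω * (condExpV p v (ind F) ω - PF) * f ω =
        ∑ ω, weight p ω * (f ω * condExpV p v (ind F) ω) - (∑ ω, weight p ω * f ω) * PF := by
      rw [Finset.sum_mul, ← Finset.sum_sub_distrib]
      exact Finset.sum_congr rfl fun ω _ => by ring
    rw [hre] at key
    linarith
  · intro X hX
    have h := harris_hybrid_ind hp0 hp1 v hX hF
    have hre : ∑ ω, weight p ω * (condExpV p v (ind F) ω - PF) * ind X ω =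
        ∑ ω, weight p ω * (ind X ω * condExpV p v (ind F) ω) - (∑ ω, weight p ω * ind X ω) * PF := by
      rw [Finset.sum_mul, ← Finset.sum_sub_distrib]
      exact Finset.sum_congr rfl fun ω _ => by ring
    rw [hre]
    linarith

end SetLevel

/-! ### The cluster-conditioning covariance inequality (Lemma P_v) -/

section Main

variable {V : Type*} [Fintype V]

omit [Fintype V] in
/-- `1_{Xᶜ} = 1 - 1_X`. [folklore] -/
private theorem ind_compl' {α : Type*} (X : Set α) (a : α) : ind Xᶜ a = 1 - ind X a := by
  by_cases ha : a ∈ X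
  · have ha' : a ∉ Xᶜ := by rw [Set.mem_compl_iff]; exact not_not.2 ha
    rw [ind_of_mem ha, ind_of_not_mem ha']; norm_num
  · rw [ind_of_not_mem ha, ind_of_mem (Set.mem_compl ha)]; norm_num

omit [Fintype V] in
/-- Indicators of equivalent memberships agree. [folklore] -/
private theorem ind_congr_iff {α β : Type*} {X : Set α} {Y : Set β} {a : α} {b : β} (h : a ∈ X ↔ b ∈ Y) :
    ind X a = ind Y b := by
  by_cases ha : a ∈ X
  · rw [ind_of_mem ha, ind_of_mem (h.1 ha)]
  · rw [ind_of_not_mem ha, ind_of_not_mem (fun hb => ha (h.2 hb))]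

/-- **Off-cluster negative correlation** (van den Berg–Häggström–Kahn, Thm. 1.3, pp. 7–8 form; here
`setSep_offCluster_negCorrelation` with the separation set `{y}`), in product-weight sums:
`E[1_N] · E[g(C_s) 1_N 1_{W_v}] ≤ E[g(C_s) 1_N] · E[1_N 1_{W_v}]` with `N = {s ↮ y}`, `W_v = {y ↔ v}` — given
`s ↮ y`, the increasing function `g(C_s)` and the event `{y ↔ v}` (which lives off the cluster of `s`) are
negatively correlated. [cite: VandenbergHaggstromKahn2005, Thm. 1.3 (p. 6) and pp. 7–8 — corollary] -/
theorem offCluster_sum_le (q : Sym2 V → unitInterval) (s y v : V) (g : Set (Sym2 V) → ℝ) (hg : Monotone g) :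
    (∑ ω, weight (fun e => (q e : ℝ)) ω * ind (openConn s y : Set (BondConfig V))ᶜ ω) *
      (∑ ω, weight (fun e => (q e : ℝ)) ω *
        (g (openEdgeCluster ω s) * ind (openConn s y : Set (BondConfig V))ᶜ ω *
          ind (openConn y v : Set (BondConfig V)) ω)) ≤
    (∑ ω, weight (fun e => (q e : ℝ)) ω * (g (openEdgeCluster ω s) * ind (openConn s y : Set (BondConfig V))ᶜ ω)) *
      (∑ ω, weight (fun e => (q e : ℝ)) ω *
        (ind (openConn s y : Set (BondConfig V))ᶜ ω * ind (openConn y v : Set (BondConfig V)) ω)) := by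
  by_cases hsy : s = y
  · subst hsy
    have h0 : ∀ ω : Set (Sym2 V), ind (openConn s s : Set (BondConfig V))ᶜ ω = 0 := fun ω =>
      ind_of_not_mem (fun h => h (SimpleGraph.Reachable.refl s))
    simp [h0]
  have hDN : {ω : BondConfig V | ∀ x ∈ ({y} : Set V), ¬ (openGraph ω).Reachable s x} =
      (openConn s y : Set (BondConfig V))ᶜ := by
    ext ω; simp [openConn]
  have hGmono : Monotone (ind (openConn y v : Set (BondConfig V))) := by
    intro a b hab
    by_cases ha : a ∈ openConn y v
    · rw [ind_of_mem ha, ind_of_mem (isUpperSet_openConn y v hab ha)]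
    · rw [ind_of_not_mem ha]; exact ind_nonneg _ _
  have hloc : ∀ ω : BondConfig V, (∀ x ∈ ({y} : Set V), ¬ (openGraph ω).Reachable s x) →
      ind (openConn y v : Set (BondConfig V))
        (ω \ {e | ∃ u ∈ e, u = s ∨ ∃ e' ∈ openEdgeCluster ω s, u ∈ e'}) =
      ind (openConn y v : Set (BondConfig V)) ω := by
    intro ω hω
    have hsy' : ¬ (openGraph ω).Reachable s y := hω y rfl
    exact ind_congr_iff (reachable_sdiff_bar_iff hsy' v)
  have hs : s ∉ ({y} : Set V) := by simpa using hsy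
  have h := setSep_offCluster_negCorrelation q s {y} hs g hg
    (ind (openConn y v : Set (BondConfig V))) hGmono hloc
  rw [measureReal_eq_sum, setIntegral_eq_sum, setIntegral_eq_sum, setIntegral_eq_sum] at h
  rw [hDN] at h
  have e1 : ∑ ω, weight (fun e => (q e : ℝ)) ω *
      (g (openEdgeCluster ω s) * ind (openConn s y : Set (BondConfig V))ᶜ ω *
        ind (openConn y v : Set (BondConfig V)) ω) =
      ∑ ω, weight (fun e => (q e : ℝ)) ω *
      (g (openEdgeCluster ω s) * ind (openConn y v : Set (BondConfig V)) ω *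
        ind (openConn s y : Set (BondConfig V))ᶜ ω) :=
    Finset.sum_congr rfl fun ω _ => by ring
  have e2 : ∑ ω, weight (fun e => (q e : ℝ)) ω *
      (ind (openConn s y : Set (BondConfig V))ᶜ ω * ind (openConn y v : Set (BondConfig V)) ω) =
      ∑ ω, weight (fun e => (q e : ℝ)) ω *
      (ind (openConn y v : Set (BondConfig V)) ω * ind (openConn s y : Set (BondConfig V))ᶜ ω) :=
    Finset.sum_congr rfl fun ω _ => by ring
  rw [e1, e2]
  exact h

/-- **The core estimate** (with an abstract increasing `f ≥ 0` that is a function of the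
cluster of `s`): if `f(ω →_S η) = f(η ∖ cut_v ω)` whenever `s ∉ C_v(ω)`, and `f` and `1{y ↔ v}` are
negatively correlated given `s ↮ y`, then
`E[1{s ↮ v} · Cov_{η}(f(η ∖ cut_v), 1_Y(η ∖ cut_v))] ≤ (1 − E[1_N 1_{W_v}]/E[1_N]) Cov(f, 1_Y)`.
[cite: Gladkov2024, Thm. 3.2 and Lemma 3.1 — corollary, derived in this file] -/
theorem cov_le_aux {p : Sym2 V → ℝ} (hp0 : ∀ e, 0 ≤ p e) (hp1 : ∀ e, p e ≤ 1) (s y v : V)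
    {f : Set (Sym2 V) → ℝ} (hfm : Monotone f) (hf0 : ∀ θ, 0 ≤ f θ)
    (hloc : ∀ ω η : Set (Sym2 V), ¬ (openGraph ω).Reachable v s → f (hybrid v ω η) = f (η \ cutSet v ω))
    (hoff : (∑ θ, weight p θ * ind (openConn s y : Set (BondConfig V))ᶜ θ) *
        (∑ θ, weight p θ * (f θ * ind (openConn s y : Set (BondConfig V))ᶜ θ *
          ind (openConn y v : Set (BondConfig V)) θ)) ≤
      (∑ θ, weight p θ * (f θ * ind (openConn s y : Set (BondConfig V))ᶜ θ)) *
        (∑ θ, weight p θ * (ind (openConn s y : Set (BondConfig V))ᶜ θ *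
          ind (openConn y v : Set (BondConfig V)) θ))) :
    ∑ ω, weight p ω * (ind {θ : Set (Sym2 V) | ¬ (openGraph θ).Reachable s v} ω *
        ((∑ η, weight p η * (f (η \ cutSet v ω) * ind (openConn s y : Set (BondConfig V)) (η \ cutSet v ω))) -
          (∑ η, weight p η * f (η \ cutSet v ω)) *
            (∑ η, weight p η * ind (openConn s y : Set (BondConfig V)) (η \ cutSet v ω)))) ≤
      (1 - (∑ θ, weight p θ * (ind (openConn s y : Set (BondConfig V))ᶜ θ *
              ind (openConn y v : Set (BondConfig V)) θ)) /
          (∑ θ, weight p θ * ind (openConn s y : Set (BondConfig V))ᶜ θ)) *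
        ((∑ θ, weight p θ * (f θ * ind (openConn s y : Set (BondConfig V)) θ)) -
          (∑ θ, weight p θ * f θ) * (∑ θ, weight p θ * ind (openConn s y : Set (BondConfig V)) θ)) := by
  set Y : Set (Sym2 V) → ℝ := ind (openConn s y : Set (BondConfig V)) with hY
  set N : Set (Sym2 V) → ℝ := ind (openConn s y : Set (BondConfig V))ᶜ with hN
  set Wv : Set (Sym2 V) → ℝ := ind (openConn y v : Set (BondConfig V)) with hWv
  set A : Set (Sym2 V) → ℝ := ind {θ : Set (Sym2 V) | ¬ (openGraph θ).Reachable s v} with hA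
  have hm : ∑ θ : Set (Sym2 V), weight p θ = 1 := sum_weight_eq_one p
  have hwt0 : ∀ θ : Set (Sym2 V), 0 ≤ weight p θ := fun θ => weight_nonneg hp0 hp1 θ
  have hNY : ∀ θ, N θ = 1 - Y θ := fun θ => ind_compl' _ θ
  -- the event `{s ↔ y}` along hybrids
  have hYv : ∀ ω η : Set (Sym2 V), (openGraph ω).Reachable v s → Y (hybrid v ω η) = Y ω := by
    intro ω η hvs
    apply ind_congr_iff
    show (openGraph (hybrid v ω η)).Reachable s y ↔ (openGraph ω).Reachable s y
    have h1 : (openGraph (hybrid v ω η)).Reachable v s := (reachable_hybrid_iff' v ω η s).2 hvs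
    have h2 : (openGraph (hybrid v ω η)).Reachable v y ↔ (openGraph ω).Reachable v y :=
      reachable_hybrid_iff' v ω η y
    constructor
    · intro h; exact hvs.symm.trans (h2.1 (h1.trans h))
    · intro h; exact h1.symm.trans (h2.2 (hvs.trans h))
  have hYcut : ∀ ω η : Set (Sym2 V), ¬ (openGraph ω).Reachable v s →
      Y (hybrid v ω η) = Y (η \ cutSet v ω) := fun ω η hvs =>
    ind_congr_iff (reachable_hybrid_iff_diff_cutSet hvs η y)
  have hWvh : ∀ ω η : Set (Sym2 V), Wv (hybrid v ω η) = Wv ω := by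
    intro ω η
    apply ind_congr_iff
    show (openGraph (hybrid v ω η)).Reachable y v ↔ (openGraph ω).Reachable y v
    rw [SimpleGraph.reachable_comm, reachable_hybrid_iff', SimpleGraph.reachable_comm]
  have hNWh : ∀ ω η : Set (Sym2 V), N (hybrid v ω η) * Wv (hybrid v ω η) = N ω * Wv ω := by
    intro ω η
    rw [hWvh]
    by_cases hyv : (openGraph ω).Reachable y v
    · have hNN : N (hybrid v ω η) = N ω := by
        rw [hNY, hNY]
        congr 1
        apply ind_congr_iff
        show (openGraph (hybrid v ω η)).Reachable s y ↔ (openGraph ω).Reachable s y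
        have h2 : (openGraph (hybrid v ω η)).Reachable v s ↔ (openGraph ω).Reachable v s :=
          reachable_hybrid_iff' v ω η s
        have hyv' : (openGraph (hybrid v ω η)).Reachable y v := by
          rw [SimpleGraph.reachable_comm, reachable_hybrid_iff', SimpleGraph.reachable_comm]; exact hyv
        constructor
        · intro h; exact (h2.1 (h.trans hyv').symm).symm.trans hyv.symm
        · intro h; exact (h2.2 (h.trans hyv).symm).symm.trans hyv'.symm
      rw [hNN]
    · rw [show Wv ω = 0 from ind_of_not_mem hyv, mul_zero, mul_zero]
  -- Step 1: the integrand is the conditional covariance given the exploration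
  have step1 : ∀ ω : Set (Sym2 V),
      A ω * ((∑ η, weight p η * (f (η \ cutSet v ω) * Y (η \ cutSet v ω))) -
        (∑ η, weight p η * f (η \ cutSet v ω)) * (∑ η, weight p η * Y (η \ cutSet v ω))) =
      condExpV p v (fun θ => f θ * Y θ) ω - condExpV p v f ω * condExpV p v Y ω := by
    intro ω
    by_cases hsv : (openGraph ω).Reachable s v
    · have hA0 : A ω = 0 := ind_of_not_mem (fun h => h hsv)
      have hvs : (openGraph ω).Reachable v s := hsv.symm
      have hη : ∀ η, Y (hybrid v ω η) = Y ω := fun η => hYv ω η hvs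
      have e1 : condExpV p v Y ω = Y ω := by
        simp only [condExpV, hη]
        rw [← Finset.sum_mul, hm, one_mul]
      have e2 : condExpV p v (fun θ => f θ * Y θ) ω = condExpV p v f ω * Y ω := by
        simp only [condExpV, hη, Finset.sum_mul]
        exact Finset.sum_congr rfl fun η _ => by ring
      rw [hA0, e1, e2]; ring
    · have hA1 : A ω = 1 := ind_of_mem hsv
      have hvs : ¬ (openGraph ω).Reachable v s := fun h => hsv h.symm
      have hη : ∀ η, Y (hybrid v ω η) = Y (η \ cutSet v ω) := fun η => hYcut ω η hvs
      have hη' : ∀ η, f (hybrid v ω η) = f (η \ cutSet v ω) := fun η => hloc ω η hvs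
      have e1 : condExpV p v Y ω = ∑ η, weight p η * Y (η \ cutSet v ω) := by
        simp only [condExpV, hη]
      have e2 : condExpV p v f ω = ∑ η, weight p η * f (η \ cutSet v ω) := by
        simp only [condExpV, hη']
      have e3 : condExpV p v (fun θ => f θ * Y θ) ω =
          ∑ η, weight p η * (f (η \ cutSet v ω) * Y (η \ cutSet v ω)) := by
        simp only [condExpV, hη, hη']
      rw [hA1, e1, e2, e3, one_mul]
  -- Step 2: the left-hand side is `E[f 1_Y] - E[f · E[1_Y | 𝓕]]`
  have step2 : ∑ ω, weight p ω * (A ω * ((∑ η, weight p η * (f (η \ cutSet v ω) * Y (η \ cutSet v ω))) -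
        (∑ η, weight p η * f (η \ cutSet v ω)) * (∑ η, weight p η * Y (η \ cutSet v ω)))) =
      (∑ θ, weight p θ * (f θ * Y θ)) - ∑ θ, weight p θ * (f θ * condExpV p v Y θ) := by
    rw [show (∑ ω, weight p ω * (A ω * ((∑ η, weight p η * (f (η \ cutSet v ω) * Y (η \ cutSet v ω))) -
        (∑ η, weight p η * f (η \ cutSet v ω)) * (∑ η, weight p η * Y (η \ cutSet v ω))))) =
        ∑ ω, weight p ω * (condExpV p v (fun θ => f θ * Y θ) ω - condExpV p v f ω * condExpV p v Y ω) from
      Finset.sum_congr rfl fun ω _ => by rw [step1 ω]]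
    simp only [mul_sub, Finset.sum_sub_distrib]
    rw [sum_condExpV p v (fun θ => f θ * Y θ),
      sum_condExpV_mul p v f (condExpV p v Y) (fun ω η => condExpV_hybrid p v Y ω η)]
  rw [step2]
  -- Step 3: decision-tree Harris–Kleitman with `F = {s ↔ y} ∪ {y ↔ v}`
  set F : Set (Set (Sym2 V)) := (openConn s y : Set (BondConfig V)) ∪ openConn y v with hF
  have hFu : IsUpperSet F := (isUpperSet_openConn s y).union (isUpperSet_openConn y v)
  have hindF : ∀ θ, ind F θ = Y θ + N θ * Wv θ := by
    intro θ
    by_cases h1 : θ ∈ (openConn s y : Set (BondConfig V))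
    · have hY1 : Y θ = 1 := ind_of_mem h1
      rw [ind_of_mem (show θ ∈ F from Set.mem_union_left _ h1), hNY, hY1]; ring
    · have hY0 : Y θ = 0 := ind_of_not_mem h1
      have hFW : ind F θ = Wv θ := ind_congr_iff (by
        show θ ∈ F ↔ θ ∈ (openConn y v : Set (BondConfig V))
        simp only [hF, Set.mem_union, or_iff_right h1])
      rw [hFW, hNY, hY0]; ring
  have hcF : ∀ ω, condExpV p v (ind F) ω = condExpV p v Y ω + N ω * Wv ω := by
    intro ω
    simp only [condExpV, hindF, hNWh, mul_add, Finset.sum_add_distrib]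
    rw [← Finset.sum_mul, hm, one_mul]
  have hHK := harris_hybrid_of_monotone hp0 hp1 v hfm hf0 hFu
  have hEF : ∑ θ, weight p θ * ind F θ = (∑ θ, weight p θ * Y θ) + ∑ θ, weight p θ * (N θ * Wv θ) := by
    simp only [hindF, mul_add, Finset.sum_add_distrib]
  have hEfcF : ∑ θ, weight p θ * (f θ * condExpV p v (ind F) θ) =
      (∑ θ, weight p θ * (f θ * condExpV p v Y θ)) + ∑ θ, weight p θ * (f θ * N θ * Wv θ) := by
    simp only [hcF, mul_add, Finset.sum_add_distrib]
    congr 1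
    exact Finset.sum_congr rfl fun θ _ => by ring
  rw [hEF, hEfcF] at hHK
  -- Step 4: bookkeeping `1_N = 1 - 1_Y`
  have hEN_eq : ∑ θ, weight p θ * N θ = 1 - ∑ θ, weight p θ * Y θ := by
    simp only [hNY, mul_sub, mul_one, Finset.sum_sub_distrib, hm]
  have hEfN_eq : ∑ θ, weight p θ * (f θ * N θ) =
      (∑ θ, weight p θ * f θ) - ∑ θ, weight p θ * (f θ * Y θ) := by
    simp only [hNY]
    rw [← Finset.sum_sub_distrib]
    exact Finset.sum_congr rfl fun θ _ => by ring
  -- abbreviations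
  set Ef := ∑ θ, weight p θ * f θ with hEf
  set EY := ∑ θ, weight p θ * Y θ with hEY
  set EfY := ∑ θ, weight p θ * (f θ * Y θ) with hEfY
  set EN := ∑ θ, weight p θ * N θ with hEN
  set ENW := ∑ θ, weight p θ * (N θ * Wv θ) with hENW
  set EfN := ∑ θ, weight p θ * (f θ * N θ) with hEfN
  set EfNW := ∑ θ, weight p θ * (f θ * N θ * Wv θ) with hEfNW
  set EfcY := ∑ θ, weight p θ * (f θ * condExpV p v Y θ) with hEfcY
  -- Step 5: the algebra
  by_cases hEN0 : EN = 0
  · have hterm : ∀ θ, weight p θ * N θ = 0 := fun θ =>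
      (Finset.sum_eq_zero_iff_of_nonneg (fun θ _ => mul_nonneg (hwt0 θ) (ind_nonneg _ θ))).1 hEN0 θ
        (Finset.mem_univ θ)
    have hENW' : ENW = 0 := Finset.sum_eq_zero fun θ _ => by
      rw [show weight p θ * (N θ * Wv θ) = (weight p θ * N θ) * Wv θ by ring, hterm, zero_mul]
    have hEfNW' : EfNW = 0 := Finset.sum_eq_zero fun θ _ => by
      rw [show weight p θ * (f θ * N θ * Wv θ) = (weight p θ * N θ) * (f θ * Wv θ) by ring, hterm, zero_mul]
    rw [hENW', zero_div, sub_zero, one_mul]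
    rw [hENW', hEfNW'] at hHK
    linarith
  · have hENpos : 0 < EN :=
      lt_of_le_of_ne (Finset.sum_nonneg fun θ _ => mul_nonneg (hwt0 θ) (ind_nonneg _ θ)) (Ne.symm hEN0)
    have key : (EfY - EfcY) * EN ≤ (EN - ENW) * (EfY - Ef * EY) := by
      have h1 : Ef * (EY + ENW) * EN ≤ (EfcY + EfNW) * EN := mul_le_mul_of_nonneg_right hHK hENpos.le
      rw [hEfN_eq] at hoff
      rw [hEN_eq] at h1 hoff ⊢
      nlinarith [h1, hoff]
    have hdiv : (1 - ENW / EN) = (EN - ENW) / EN := by rw [sub_div, div_self hEN0]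
    rw [hdiv, div_mul_eq_mul_div, le_div_iff₀ hENpos]
    exact key

/-- **Lemma P_v (cluster conditioning explains at least the fraction `P(y ↔ v | y ↮ s)` of the covariance).**
For weights `q_e ∈ [0, 1]`, vertices `s, y, v` and a monotone `g ≥ 0`, with `w = (q_e)`, `Y = {s ↔ y}`,
`cut_v(ω) = {e | e meets C_v(ω)}` and fresh `η`:
`Σ_ω w(ω) 1{s ↮ v}(ω) · [E_η g(C_s(η∖cut_v ω)) 1_Y(η∖cut_v ω) − E_η g(C_s(η∖cut_v ω)) · E_η 1_Y(η∖cut_v ω)]`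
`≤ (1 − E[1_{Yᶜ ∩ {y↔v}}] / E[1_{Yᶜ}]) · (E[g(C_s) 1_Y] − E[g(C_s)] E[1_Y])`
(the left side is `E[Cov(g(C_s), 1_Y | 𝓕(C_v))]`; `x / 0 = 0`).  Proof: `cov_le_aux` with the cluster locality
`openEdgeCluster_hybrid_eq` and the off-cluster inequality `offCluster_sum_le`.
[cite: Gladkov2024, Thm. 3.2 (p. 4); VandenbergHaggstromKahn2005, Thm. 1.3 (p. 6) — corollary, derived in this file] -/
theorem clusterConditioning_cov_le (q : Sym2 V → unitInterval) (s y v : V)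
    (g : Set (Sym2 V) → ℝ) (hg : Monotone g) (hg0 : ∀ S, 0 ≤ g S) :
    ∑ ω, weight (fun e => (q e : ℝ)) ω *
        (ind {θ : Set (Sym2 V) | ¬ (openGraph θ).Reachable s v} ω *
          ((∑ η, weight (fun e => (q e : ℝ)) η *
              (g (openEdgeCluster (η \ cutSet v ω) s) *
                ind (openConn s y : Set (BondConfig V)) (η \ cutSet v ω))) -
            (∑ η, weight (fun e => (q e : ℝ)) η * g (openEdgeCluster (η \ cutSet v ω) s)) *
              (∑ η, weight (fun e => (q e : ℝ)) η *
                ind (openConn s y : Set (BondConfig V)) (η \ cutSet v ω)))) ≤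
      (1 - (∑ η, weight (fun e => (q e : ℝ)) η *
              ind ((openConn s y : Set (BondConfig V))ᶜ ∩ openConn y v) η) /
          (∑ η, weight (fun e => (q e : ℝ)) η * ind (openConn s y : Set (BondConfig V))ᶜ η)) *
        ((∑ η, weight (fun e => (q e : ℝ)) η *
            (g (openEdgeCluster η s) * ind (openConn s y : Set (BondConfig V)) η)) -
          (∑ η, weight (fun e => (q e : ℝ)) η * g (openEdgeCluster η s)) *
            (∑ η, weight (fun e => (q e : ℝ)) η * ind (openConn s y : Set (BondConfig V)) η)) := by
  have hw0 : ∀ e, 0 ≤ (fun e => (q e : ℝ)) e := fun e => (q e).2.1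
  have hw1 : ∀ e, (fun e => (q e : ℝ)) e ≤ 1 := fun e => (q e).2.2
  have hfm : Monotone (fun θ : Set (Sym2 V) => g (openEdgeCluster θ s)) := fun a b hab =>
    hg (openEdgeCluster_mono hab s)
  have hf0 : ∀ θ : Set (Sym2 V), 0 ≤ (fun θ : Set (Sym2 V) => g (openEdgeCluster θ s)) θ := fun θ => hg0 _
  have hloc : ∀ ω η : Set (Sym2 V), ¬ (openGraph ω).Reachable v s →
      (fun θ : Set (Sym2 V) => g (openEdgeCluster θ s)) (hybrid v ω η) =
      (fun θ : Set (Sym2 V) => g (openEdgeCluster θ s)) (η \ cutSet v ω) := by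
    intro ω η hvs
    simp only [openEdgeCluster_hybrid_eq hvs]
  have hoff := offCluster_sum_le q s y v g hg
  have h := cov_le_aux hw0 hw1 s y v hfm hf0 hloc hoff
  have hinter : ∑ η, weight (fun e => (q e : ℝ)) η *
      ind ((openConn s y : Set (BondConfig V))ᶜ ∩ openConn y v) η =
      ∑ η, weight (fun e => (q e : ℝ)) η *
      (ind (openConn s y : Set (BondConfig V))ᶜ η * ind (openConn y v : Set (BondConfig V)) η) :=
    Finset.sum_congr rfl fun η _ => by rw [ind_inter]
  rw [hinter]
  exact h

/-- **Lemma P_v in the letter of the hull-port induction** (the hypothesis `hPv` of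
`HullPort.taB_insert_le`, with `taB`, `taC`, `delE`, `cut`, `avoidEv` unfolded): the
avoided set `{v}` written as `∀ t ∈ {v}` / `∃ x ∈ {v}`, and the undeleted expectations written with `η ∖ ∅`.
[cite: Gladkov2024, Thm. 3.2 (p. 4); VandenbergHaggstromKahn2005, Thm. 1.3 (p. 6) — corollary, derived in this file] -/
theorem clusterConditioning_cov_le' (q : Sym2 V → unitInterval) (s y v : V)
    (g : Set (Sym2 V) → ℝ) (hg : Monotone g) (hg0 : ∀ S, 0 ≤ g S) :
    ∑ ω, weight (fun e => (q e : ℝ)) ω *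
        (ind {ω : Set (Sym2 V) | ∀ t ∈ ({v} : Set V), ¬ (openGraph ω).Reachable s t} ω *
          ((∑ η, weight (fun e => (q e : ℝ)) η *
              (g (openEdgeCluster (η \ {e | ∃ u ∈ e, ∃ x ∈ ({v} : Set V), (openGraph ω).Reachable x u}) s) *
                ind (openConn s y : Set (BondConfig V))
                  (η \ {e | ∃ u ∈ e, ∃ x ∈ ({v} : Set V), (openGraph ω).Reachable x u}))) -
            (∑ η, weight (fun e => (q e : ℝ)) η *
                g (openEdgeCluster (η \ {e | ∃ u ∈ e, ∃ x ∈ ({v} : Set V), (openGraph ω).Reachable x u}) s)) *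
              (∑ η, weight (fun e => (q e : ℝ)) η *
                ind (openConn s y : Set (BondConfig V))
                  (η \ {e | ∃ u ∈ e, ∃ x ∈ ({v} : Set V), (openGraph ω).Reachable x u})))) ≤
      (1 - (∑ η, weight (fun e => (q e : ℝ)) η *
              ind ((openConn s y : Set (BondConfig V))ᶜ ∩ openConn y v) (η \ ∅)) /
          (∑ η, weight (fun e => (q e : ℝ)) η * ind (openConn s y : Set (BondConfig V))ᶜ (η \ ∅))) *
        ((∑ η, weight (fun e => (q e : ℝ)) η *
            (g (openEdgeCluster (η \ ∅) s) * ind (openConn s y : Set (BondConfig V)) (η \ ∅))) -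
          (∑ η, weight (fun e => (q e : ℝ)) η * g (openEdgeCluster (η \ ∅) s)) *
            (∑ η, weight (fun e => (q e : ℝ)) η * ind (openConn s y : Set (BondConfig V)) (η \ ∅))) := by
  have h := clusterConditioning_cov_le q s y v g hg hg0
  have e1 : ∀ ω : Set (Sym2 V),
      {e : Sym2 V | ∃ u ∈ e, ∃ x ∈ ({v} : Set V), (openGraph ω).Reachable x u} = cutSet v ω := by
    intro ω; ext e; simp [cutSet]
  have e2 : {ω : Set (Sym2 V) | ∀ t ∈ ({v} : Set V), ¬ (openGraph ω).Reachable s t} =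
      {ω | ¬ (openGraph ω).Reachable s v} := by
    ext ω; simp
  simp only [e1, e2, Set.sdiff_empty]
  exact h

end Main

end ClusterConditioning

end Literature.Probability.Percolation

end
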